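import Mathlib
import Summits.ValiantsHypothesis.ValiantsHypothesis.Theses.NewtonUnitEquations

/-!
# Line `corner-log-linearization` — LEAD skeleton (reshaped) for crux `TwoProducts` (stmt-ValiantsHypothesis-5906)

Crux decl `Summit.ValiantsHypothesis.ValiantsHypothesis.Theses.NewtonUnitEquations.TwoProducts`:
`∃ a b, ∀ m t (f g : Fin m → ℂ[X,Y])`, `t`-sparse ⇒ `#extremePoints conv(supp(∏ f − ∏ g)) ≤ 2^(a·m)·(t+2)^b`.

Lead reshape (session prover-line-stmt-ValiantsHypothesis-5906-0) of the planner's skeleton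
`Lines/corner-log-linearization.lean`: the L-sized `stub_cornerLocalisation` is split into three M-sized registered
stubs — `stub_sweep` (plane geometry of integer weights: sectors between consecutive critical directions, ≤ 4|D|+4 of
them, each a positive cone over two integer boundary vectors), `stub_sectorCover` (every combinatorial vertex of
`∏ f − ∏ g` is a sector vertex for one of the sectors' constant top-assignments; count ≤ #sectors × per-sector bound) and
`stub_coneChart` (the injective additive chart `L = (r₁; r₂)` carries a sector with top-assignment `(μ, ν)` to a LOCAL
instance `u, v` with constant terms `1`; per-sector vertices ≤ south-west vertices of `∏ u − ∏ v` plus `2`).  The other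
stubs are the planner's: `stub_exposure`, `stub_powerSumCriterion` (the lever), `stub_raySeries` (`t ≤ 2` rung) and the
OPEN engine `stub_logSumNewton` (held by the lead).  Registered stub statements are Mathlib-only (all line objects
inlined) so that each lands as an independent `--supports` file; the readable `def`s below are definitionally the same.

Weights are INTEGER vectors `w ∈ ℤ²`, `wt w e = w₀e₀ + w₁e₁`; a vertex is a UNIQUE MINIMISER (`IsStrictMin`) of `wt w`
on a support; `swVertSet` = unique minimisers for some `w` with both `wᵢ > 0`; `logPowerSum R u v = Σ_{r=1}^{R}
((−1)^{r+1}/r)·(Σ_i (u_i − 1)^r − Σ_i (v_i − 1)^r)`; `logVertSet u v` = stable south-west vertices of the log series.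

COMPOSITION (kernel-checked below, no sorry outside `stub_*`): stubs 5–7 give the local south-west bound
`2^((a+1)n)(t+2)^b` (`local_bound`); stub 4 turns it into a per-sector bound `+2`; stubs 2–3 give
`#vertSet ≤ (4|D|+4)·(N+2)` with `|D| ≤ 2mt²` for families of NONZERO factors, the zero-factor cases being reduced to
that one by the doubling trick `∏g − ∏g' = −∏g` (`g'` = `g` with one factor doubled); stub 1 injects the extreme points
into `emb '' vertSet`; `bound_arith` closes with `(A, B) = (a+2, b+8)`.
-/

set_option linter.dupNamespace false

namespace Summit.ValiantsHypothesis.ValiantsHypothesis.Cruxes.TwoProducts.CornerLogLinearization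

open scoped BigOperators Classical

noncomputable section

/-! ## Objects of the line (readable defs; the registered stubs inline them verbatim) -/

/-- Exponent vectors of bivariate monomials. -/
abbrev Expo := Fin 2 →₀ ℕ

/-- The embedding `ℕ² → ℝ²` used VERBATIM by the crux. -/
abbrev emb (e : Expo) : Fin 2 → ℝ := fun i => ((e i : ℕ) : ℝ)

/-- The integer linear form `⟨w, e⟩ = w₀ e₀ + w₁ e₁`. -/
def wt (w : Fin 2 → ℤ) (e : Expo) : ℤ := w 0 * (e 0 : ℤ) + w 1 * (e 1 : ℤ)

/-- `e` is the UNIQUE minimiser of `wt w` on the finite set `S` (in particular `e ∈ S`). -/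
def IsStrictMin (w : Fin 2 → ℤ) (S : Finset Expo) (e : Expo) : Prop :=
  e ∈ S ∧ ∀ e' ∈ S, e' ≠ e → wt w e < wt w e'

/-- Combinatorial vertex set: exponents that are the unique minimiser of SOME integer form on the support. -/
def vertSet (F : MvPolynomial (Fin 2) ℂ) : Set Expo :=
  {e | ∃ w : Fin 2 → ℤ, IsStrictMin w F.support e}

/-- South-west vertex set: unique minimisers for an integer form with BOTH weights strictly positive. -/
def swVertSet (D : MvPolynomial (Fin 2) ℂ) : Set Expo :=
  {e | ∃ w : Fin 2 → ℤ, 0 < w 0 ∧ 0 < w 1 ∧ IsStrictMin w D.support e}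

/-- Order-`R` log power-sum polynomial of a local instance. -/
def logPowerSum {n : ℕ} (R : ℕ) (u v : Fin n → MvPolynomial (Fin 2) ℂ) : MvPolynomial (Fin 2) ℂ :=
  ∑ r ∈ Finset.Icc 1 R, ((-1 : ℂ) ^ (r + 1) / (r : ℂ)) • (∑ i, (u i - 1) ^ r - ∑ i, (v i - 1) ^ r)

/-- Stable south-west vertices of the log series. -/
def logVertSet {n : ℕ} (u v : Fin n → MvPolynomial (Fin 2) ℂ) : Set Expo :=
  {e | ∃ w : Fin 2 → ℤ, 0 < w 0 ∧ 0 < w 1 ∧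
    ∀ R : ℕ, wt w e < (R : ℤ) → IsStrictMin w (logPowerSum R u v).support e}

variable {m : ℕ}

/-- Sector data `(μ, ν, r₁, r₂)` is ADAPTED to `(f, g)`: the chart rows `r₁, r₂ ∈ ℤ²` are independent and weakly
minimised at the assigned tops `μ j` / `ν j` on every support (so the chart `p ↦ (⟨r₁,p−μ_j⟩, ⟨r₂,p−μ_j⟩)` lands in `ℕ²`). -/
def Adapted (f g : Fin m → MvPolynomial (Fin 2) ℂ) (μ ν : Fin m → Expo) (r₁ r₂ : Fin 2 → ℤ) : Prop :=
  r₁ 0 * r₂ 1 ≠ r₁ 1 * r₂ 0 ∧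
    (∀ j, ∀ p ∈ (f j).support, wt r₁ (μ j) ≤ wt r₁ p ∧ wt r₂ (μ j) ≤ wt r₂ p) ∧
    (∀ j, ∀ p ∈ (g j).support, wt r₁ (ν j) ≤ wt r₁ p ∧ wt r₂ (ν j) ≤ wt r₂ p)

/-- The SECTOR VERTEX SET of sector data: exponents that are the unique `w`-minimiser of `supp(∏f − ∏g)` for a weight
`w = a•r₁ + b•r₂` (`a, b > 0` integers) which makes every `μ j` / `ν j` the unique `w`-minimiser of its factor. -/
def sectSet (f g : Fin m → MvPolynomial (Fin 2) ℂ) (μ ν : Fin m → Expo) (r₁ r₂ : Fin 2 → ℤ) : Set Expo :=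
  {e | ∃ a b : ℤ, 0 < a ∧ 0 < b ∧ (∀ j, IsStrictMin (a • r₁ + b • r₂) (f j).support (μ j)) ∧
    (∀ j, IsStrictMin (a • r₁ + b • r₂) (g j).support (ν j)) ∧
    IsStrictMin (a • r₁ + b • r₂) (∏ j, f j - ∏ j, g j).support e}

/-! ## Registered stubs (the ONLY sorries of this file; statements Mathlib-only, objects inlined) -/

/-- STUB 1 — EXPOSURE BY AN INTEGER FORM (M).  Every extreme point of `conv(emb '' S)` (`S ⊂ ℕ²` finite) is `emb e` for an
`e ∈ S` that is the unique minimiser on `S` of an integer linear form.  (Strict separation of an extreme point of a finite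
set from the hull of the others — `geometric_hahn_banach_point_closed`, cf. the tree's
`KPTT.EPRS.exists_support_of_convexIndependent` / sibling kit `exists_strict_sep_of_mem_extremePoints_convexHull` — gives a
real form with positive gaps on the finite set; round `K·ξ` coordinatewise for `K` large: integer gaps stay positive.) -/
theorem stub_exposure : ∀ (S : Finset (Fin 2 →₀ ℕ)) (p : Fin 2 → ℝ),
    p ∈ Set.extremePoints ℝ (convexHull ℝ
      ((fun e : Fin 2 →₀ ℕ => fun i : Fin 2 => ((e i : ℕ) : ℝ)) '' (S : Set (Fin 2 →₀ ℕ)))) →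
    ∃ e : Fin 2 →₀ ℕ, (fun i : Fin 2 => ((e i : ℕ) : ℝ)) = p ∧ ∃ w : Fin 2 → ℤ,
      e ∈ S ∧ ∀ e' ∈ S, e' ≠ e →
        w 0 * (e 0 : ℤ) + w 1 * (e 1 : ℤ) < w 0 * (e' 0 : ℤ) + w 1 * (e' 1 : ℤ) := by
  sorry

/-- STUB 2 — SWEEP (M; plane geometry of integer weights).  For a finite set `D ⊂ ℤ²` of critical vectors there are
`≤ 4|D| + 4` SECTORS, each given by two independent integer boundary vectors `(r₁, r₂)`, such that every integer weight
`w` off the axes and off all critical lines `⟨w, d⟩ = 0` is, after scaling by some `K > 0`, a combination `a•r₁ + b•r₂`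
with `a, b > 0`, and `⟨w, d⟩ > 0 ⇒ ⟨r₁, d⟩ ≥ 0 ∧ ⟨r₂, d⟩ ≥ 0` for `d ∈ D` (sign consistency up to the boundary).
(Per open quadrant, sort the critical slopes; a sector is the open cone between consecutive ones, its boundary rays are
the quadrant's axes or rational directions `±d^⊥`; `⟨(1,σ), d⟩ = d₀ + σ d₁` is affine in the slope `σ`, so its sign is
constant between consecutive roots and weakly the same at the two ends; `a, b, K` by Cramer's rule.  The sibling kit
`Cruxes/DissociatedFixedK/FullProof-annihilator-product-functional.lean` §E2 has the checked sweep count.) -/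
theorem stub_sweep : ∀ (D : Finset (Fin 2 → ℤ)),
    ∃ Sec : Finset ((Fin 2 → ℤ) × (Fin 2 → ℤ)), Sec.card ≤ 4 * D.card + 4 ∧
      ∀ w : Fin 2 → ℤ, w 0 ≠ 0 → w 1 ≠ 0 → (∀ d ∈ D, w 0 * d 0 + w 1 * d 1 ≠ 0) →
        ∃ rr ∈ Sec, rr.1 0 * rr.2 1 ≠ rr.1 1 * rr.2 0 ∧
          ∃ a b K : ℤ, 0 < a ∧ 0 < b ∧ 0 < K ∧ K • w = a • rr.1 + b • rr.2 ∧
            ∀ d ∈ D, 0 < w 0 * d 0 + w 1 * d 1 →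
              0 ≤ rr.1 0 * d 0 + rr.1 1 * d 1 ∧ 0 ≤ rr.2 0 * d 0 + rr.2 1 * d 1 := by
  sorry

/-- STUB 3 — SECTOR COVER (M).  For NONZERO `t`-sparse factors and a family `Sec` of sectors with the sweep property
relative to the within-factor difference vectors (every integer weight off the axes and without ties inside any single
factor is, up to scaling, a positive combination of the boundary vectors of some sector in `Sec`, weakly order-consistently
on each factor's support), if every ADAPTED sector datum `(μ, ν, r₁, r₂)` has `≤ B` sector vertices then
`#vertSet(∏f − ∏g) ≤ |Sec|·B`.  (Perturb a witness weight of a vertex `e` to a generic one keeping `e` the strict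
minimiser — integer gaps are `≥ 1`, so `K·w + v` with `v` off finitely many lines and `K` large works; take the sector
`(r₁, r₂)` of the generic weight and `μ j, ν j :=` its unique minimisers on the factors: the datum is adapted by weak
consistency, `e` is one of its sector vertices, and two weights in the same sector have the SAME minimisers — weak
consistency both ways gives `⟨r_i, μ_j − μ'_j⟩ = 0`, `i = 1, 2`, and `det(r₁,r₂) ≠ 0` — so `vertSet ⊆ ⋃_{rr ∈ Sec} sectSet(μ(rr), ν(rr), rr)`.) -/
theorem stub_sectorCover : ∀ (m t : ℕ) (f g : Fin m → MvPolynomial (Fin 2) ℂ),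
    (∀ j, (f j).support.card ≤ t) → (∀ j, (g j).support.card ≤ t) → (∀ j, f j ≠ 0) → (∀ j, g j ≠ 0) →
    ∀ (Sec : Finset ((Fin 2 → ℤ) × (Fin 2 → ℤ))),
    (∀ w : Fin 2 → ℤ, w 0 ≠ 0 → w 1 ≠ 0 →
      (∀ j, ∀ p ∈ (f j).support, ∀ q ∈ (f j).support, p ≠ q →
        w 0 * (p 0 : ℤ) + w 1 * (p 1 : ℤ) ≠ w 0 * (q 0 : ℤ) + w 1 * (q 1 : ℤ)) →
      (∀ j, ∀ p ∈ (g j).support, ∀ q ∈ (g j).support, p ≠ q →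
        w 0 * (p 0 : ℤ) + w 1 * (p 1 : ℤ) ≠ w 0 * (q 0 : ℤ) + w 1 * (q 1 : ℤ)) →
      ∃ rr ∈ Sec, rr.1 0 * rr.2 1 ≠ rr.1 1 * rr.2 0 ∧
        ∃ a b K : ℤ, 0 < a ∧ 0 < b ∧ 0 < K ∧ K • w = a • rr.1 + b • rr.2 ∧
          (∀ j, ∀ p ∈ (f j).support, ∀ q ∈ (f j).support,
            w 0 * (p 0 : ℤ) + w 1 * (p 1 : ℤ) < w 0 * (q 0 : ℤ) + w 1 * (q 1 : ℤ) →
            rr.1 0 * (p 0 : ℤ) + rr.1 1 * (p 1 : ℤ) ≤ rr.1 0 * (q 0 : ℤ) + rr.1 1 * (q 1 : ℤ) ∧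
            rr.2 0 * (p 0 : ℤ) + rr.2 1 * (p 1 : ℤ) ≤ rr.2 0 * (q 0 : ℤ) + rr.2 1 * (q 1 : ℤ)) ∧
          (∀ j, ∀ p ∈ (g j).support, ∀ q ∈ (g j).support,
            w 0 * (p 0 : ℤ) + w 1 * (p 1 : ℤ) < w 0 * (q 0 : ℤ) + w 1 * (q 1 : ℤ) →
            rr.1 0 * (p 0 : ℤ) + rr.1 1 * (p 1 : ℤ) ≤ rr.1 0 * (q 0 : ℤ) + rr.1 1 * (q 1 : ℤ) ∧
            rr.2 0 * (p 0 : ℤ) + rr.2 1 * (p 1 : ℤ) ≤ rr.2 0 * (q 0 : ℤ) + rr.2 1 * (q 1 : ℤ))) →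
    ∀ B : ℕ,
    (∀ (μ ν : Fin m → (Fin 2 →₀ ℕ)) (r₁ r₂ : Fin 2 → ℤ),
      (r₁ 0 * r₂ 1 ≠ r₁ 1 * r₂ 0 ∧
        (∀ j, ∀ p ∈ (f j).support,
          r₁ 0 * ((μ j) 0 : ℤ) + r₁ 1 * ((μ j) 1 : ℤ) ≤ r₁ 0 * (p 0 : ℤ) + r₁ 1 * (p 1 : ℤ) ∧
          r₂ 0 * ((μ j) 0 : ℤ) + r₂ 1 * ((μ j) 1 : ℤ) ≤ r₂ 0 * (p 0 : ℤ) + r₂ 1 * (p 1 : ℤ)) ∧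
        (∀ j, ∀ p ∈ (g j).support,
          r₁ 0 * ((ν j) 0 : ℤ) + r₁ 1 * ((ν j) 1 : ℤ) ≤ r₁ 0 * (p 0 : ℤ) + r₁ 1 * (p 1 : ℤ) ∧
          r₂ 0 * ((ν j) 0 : ℤ) + r₂ 1 * ((ν j) 1 : ℤ) ≤ r₂ 0 * (p 0 : ℤ) + r₂ 1 * (p 1 : ℤ))) →
      {e : Fin 2 →₀ ℕ | ∃ a b : ℤ, 0 < a ∧ 0 < b ∧
        (∀ j, μ j ∈ (f j).support ∧ ∀ e' ∈ (f j).support, e' ≠ μ j →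
          (a • r₁ + b • r₂) 0 * ((μ j) 0 : ℤ) + (a • r₁ + b • r₂) 1 * ((μ j) 1 : ℤ) <
            (a • r₁ + b • r₂) 0 * (e' 0 : ℤ) + (a • r₁ + b • r₂) 1 * (e' 1 : ℤ)) ∧
        (∀ j, ν j ∈ (g j).support ∧ ∀ e' ∈ (g j).support, e' ≠ ν j →
          (a • r₁ + b • r₂) 0 * ((ν j) 0 : ℤ) + (a • r₁ + b • r₂) 1 * ((ν j) 1 : ℤ) <
            (a • r₁ + b • r₂) 0 * (e' 0 : ℤ) + (a • r₁ + b • r₂) 1 * (e' 1 : ℤ)) ∧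
        (e ∈ (∏ j, f j - ∏ j, g j).support ∧ ∀ e' ∈ (∏ j, f j - ∏ j, g j).support, e' ≠ e →
          (a • r₁ + b • r₂) 0 * (e 0 : ℤ) + (a • r₁ + b • r₂) 1 * (e 1 : ℤ) <
            (a • r₁ + b • r₂) 0 * (e' 0 : ℤ) + (a • r₁ + b • r₂) 1 * (e' 1 : ℤ))}.ncard ≤ B) →
    {e : Fin 2 →₀ ℕ | ∃ w : Fin 2 → ℤ, e ∈ (∏ j, f j - ∏ j, g j).support ∧
      ∀ e' ∈ (∏ j, f j - ∏ j, g j).support, e' ≠ e →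
        w 0 * (e 0 : ℤ) + w 1 * (e 1 : ℤ) < w 0 * (e' 0 : ℤ) + w 1 * (e' 1 : ℤ)}.ncard ≤ Sec.card * B := by
  sorry

/-- STUB 4 — CONE CHART (M).  For `t`-sparse factors and an ADAPTED sector datum whose sector vertex set is nonempty there
is a LOCAL instance `u, v : Fin m → ℂ[X,Y]` (`t`-sparse, constant terms `1`) with
`#sectSet ≤ #swVertSet(∏u − ∏v) + 2`.  (Chart `L p = (⟨r₁,p⟩, ⟨r₂,p⟩)`, injective since `det ≠ 0`;
`u_j := Σ_{p ∈ supp f_j} (coeff_p f_j / coeff_{μ_j} f_j)·X^{L(p) − L(μ_j)}` — exponents in `ℕ²` by adaptedness, constant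
term `1`, `|supp u_j| = |supp f_j|`; expanding both products over words (`Finset.prod_univ_sum` / `Fintype.piFinset`)
and reindexing `p_j ↔ L(p_j − μ_j)`: `coeff_{L(e − Σμ)}(∏u) = coeff_e(∏f)/∏coeff_{μ_j}f_j`; for `w = a•r₁ + b•r₂`,
`wt w p − wt w q = ⟨(a,b), L p − L q⟩`; so if `Σμ = Σν` and the leading coefficients agree the sector vertices are `L`-charted
onto south-west vertices of `∏u − ∏v`, and otherwise a sector vertex is one of the two product corners `Σμ`, `Σν`.) -/
theorem stub_coneChart : ∀ (m t : ℕ) (f g : Fin m → MvPolynomial (Fin 2) ℂ),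
    (∀ j, (f j).support.card ≤ t) → (∀ j, (g j).support.card ≤ t) →
    ∀ (μ ν : Fin m → (Fin 2 →₀ ℕ)) (r₁ r₂ : Fin 2 → ℤ),
    (r₁ 0 * r₂ 1 ≠ r₁ 1 * r₂ 0 ∧
      (∀ j, ∀ p ∈ (f j).support,
        r₁ 0 * ((μ j) 0 : ℤ) + r₁ 1 * ((μ j) 1 : ℤ) ≤ r₁ 0 * (p 0 : ℤ) + r₁ 1 * (p 1 : ℤ) ∧
        r₂ 0 * ((μ j) 0 : ℤ) + r₂ 1 * ((μ j) 1 : ℤ) ≤ r₂ 0 * (p 0 : ℤ) + r₂ 1 * (p 1 : ℤ)) ∧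
      (∀ j, ∀ p ∈ (g j).support,
        r₁ 0 * ((ν j) 0 : ℤ) + r₁ 1 * ((ν j) 1 : ℤ) ≤ r₁ 0 * (p 0 : ℤ) + r₁ 1 * (p 1 : ℤ) ∧
        r₂ 0 * ((ν j) 0 : ℤ) + r₂ 1 * ((ν j) 1 : ℤ) ≤ r₂ 0 * (p 0 : ℤ) + r₂ 1 * (p 1 : ℤ))) →
    {e : Fin 2 →₀ ℕ | ∃ a b : ℤ, 0 < a ∧ 0 < b ∧
        (∀ j, μ j ∈ (f j).support ∧ ∀ e' ∈ (f j).support, e' ≠ μ j →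
          (a • r₁ + b • r₂) 0 * ((μ j) 0 : ℤ) + (a • r₁ + b • r₂) 1 * ((μ j) 1 : ℤ) <
            (a • r₁ + b • r₂) 0 * (e' 0 : ℤ) + (a • r₁ + b • r₂) 1 * (e' 1 : ℤ)) ∧
        (∀ j, ν j ∈ (g j).support ∧ ∀ e' ∈ (g j).support, e' ≠ ν j →
          (a • r₁ + b • r₂) 0 * ((ν j) 0 : ℤ) + (a • r₁ + b • r₂) 1 * ((ν j) 1 : ℤ) <
            (a • r₁ + b • r₂) 0 * (e' 0 : ℤ) + (a • r₁ + b • r₂) 1 * (e' 1 : ℤ)) ∧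
        (e ∈ (∏ j, f j - ∏ j, g j).support ∧ ∀ e' ∈ (∏ j, f j - ∏ j, g j).support, e' ≠ e →
          (a • r₁ + b • r₂) 0 * (e 0 : ℤ) + (a • r₁ + b • r₂) 1 * (e 1 : ℤ) <
            (a • r₁ + b • r₂) 0 * (e' 0 : ℤ) + (a • r₁ + b • r₂) 1 * (e' 1 : ℤ))}.Nonempty →
    ∃ u v : Fin m → MvPolynomial (Fin 2) ℂ,
      (∀ i, (u i).support.card ≤ t) ∧ (∀ i, (v i).support.card ≤ t) ∧
      (∀ i, MvPolynomial.coeff 0 (u i) = 1) ∧ (∀ i, MvPolynomial.coeff 0 (v i) = 1) ∧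
      {e : Fin 2 →₀ ℕ | ∃ a b : ℤ, 0 < a ∧ 0 < b ∧
        (∀ j, μ j ∈ (f j).support ∧ ∀ e' ∈ (f j).support, e' ≠ μ j →
          (a • r₁ + b • r₂) 0 * ((μ j) 0 : ℤ) + (a • r₁ + b • r₂) 1 * ((μ j) 1 : ℤ) <
            (a • r₁ + b • r₂) 0 * (e' 0 : ℤ) + (a • r₁ + b • r₂) 1 * (e' 1 : ℤ)) ∧
        (∀ j, ν j ∈ (g j).support ∧ ∀ e' ∈ (g j).support, e' ≠ ν j →
          (a • r₁ + b • r₂) 0 * ((ν j) 0 : ℤ) + (a • r₁ + b • r₂) 1 * ((ν j) 1 : ℤ) <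
            (a • r₁ + b • r₂) 0 * (e' 0 : ℤ) + (a • r₁ + b • r₂) 1 * (e' 1 : ℤ)) ∧
        (e ∈ (∏ j, f j - ∏ j, g j).support ∧ ∀ e' ∈ (∏ j, f j - ∏ j, g j).support, e' ≠ e →
          (a • r₁ + b • r₂) 0 * (e 0 : ℤ) + (a • r₁ + b • r₂) 1 * (e 1 : ℤ) <
            (a • r₁ + b • r₂) 0 * (e' 0 : ℤ) + (a • r₁ + b • r₂) 1 * (e' 1 : ℤ))}.ncard ≤
      {e : Fin 2 →₀ ℕ | ∃ w : Fin 2 → ℤ, 0 < w 0 ∧ 0 < w 1 ∧ e ∈ (∏ i, u i - ∏ i, v i).support ∧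
        ∀ e' ∈ (∏ i, u i - ∏ i, v i).support, e' ≠ e →
          w 0 * (e 0 : ℤ) + w 1 * (e 1 : ℤ) < w 0 * (e' 0 : ℤ) + w 1 * (e' 1 : ℤ)}.ncard + 2 := by
  sorry

/-- STUB 5 — POWER-SUM CRITERION (M–L; the lever).  For factors with constant term `1` and a strictly positive integer
weight `w`, `e` is the unique `w`-minimiser of `supp(∏ u − ∏ v)` iff it is the unique `w`-minimiser of `supp Λ_R`, for
every `R > wt w e`.  (Polynomial proof: `θ_w = w₀X∂_X + w₁Y∂_Y` is a derivation scaling `X^p` by `wt w p`; work modulo the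
span `I_R` of monomials of `w`-weight `≥ R` — every monomial of a tail `h = u_i − 1` has weight `≥ 1`, so `h^R ∈ I_R`,
`(1+h)·Σ_{s<R}(−h)^s ≡ 1` and `θ log_R(1+h) ≡ θh·Σ_{s<R}(−h)^s`, whence `θP·Q − P·θQ ≡ PQ·θΛ_R (mod I_R)` for
`P = ∏u`, `Q = ∏v`; lowest `w`-components: `in(θP·Q − P·θQ) = d·in(P − Q)` (`d ≥ 1` the `w`-order of `P − Q`),
`in(PQ·θΛ_R) = in(θΛ_R) = d'·in(Λ_R)` below weight `R`; so below weight `R` a strict minimiser on either side is one on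
the other.  Both sides are false when `∏u = ∏v`.) -/
theorem stub_powerSumCriterion : ∀ (n : ℕ) (u v : Fin n → MvPolynomial (Fin 2) ℂ),
    (∀ i, MvPolynomial.coeff 0 (u i) = 1) → (∀ i, MvPolynomial.coeff 0 (v i) = 1) →
    ∀ (w : Fin 2 → ℤ), 0 < w 0 → 0 < w 1 →
    ∀ (e : Fin 2 →₀ ℕ) (R : ℕ), w 0 * (e 0 : ℤ) + w 1 * (e 1 : ℤ) < (R : ℤ) →
      ((e ∈ (∏ i, u i - ∏ i, v i).support ∧ ∀ e' ∈ (∏ i, u i - ∏ i, v i).support, e' ≠ e →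
          w 0 * (e 0 : ℤ) + w 1 * (e 1 : ℤ) < w 0 * (e' 0 : ℤ) + w 1 * (e' 1 : ℤ)) ↔
        (e ∈ (∑ r ∈ Finset.Icc 1 R, ((-1 : ℂ) ^ (r + 1) / (r : ℂ)) •
              (∑ i, (u i - 1) ^ r - ∑ i, (v i - 1) ^ r)).support ∧
          ∀ e' ∈ (∑ r ∈ Finset.Icc 1 R, ((-1 : ℂ) ^ (r + 1) / (r : ℂ)) •
              (∑ i, (u i - 1) ^ r - ∑ i, (v i - 1) ^ r)).support, e' ≠ e →
            w 0 * (e 0 : ℤ) + w 1 * (e 1 : ℤ) < w 0 * (e' 0 : ℤ) + w 1 * (e' 1 : ℤ))) := by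
  sorry

/-- STUB 6 — RAY SERIES (M; the binomial rung `t ≤ 2`).  If every factor has at most two monomials (so `u_i = 1 + c_i X^{g_i}`),
`supp Λ_R` lies on the `≤ 2n` rays `ℕ_{≥1}·g_i`, `ℕ_{≥1}·g'_i`, and two stable unique minimisers on one ray are impossible
(the lower one is in `supp Λ_R` for all large `R` and beats the upper one for every positive weight): `#logVertSet ≤ 2n`. -/
theorem stub_raySeries : ∀ (n : ℕ) (u v : Fin n → MvPolynomial (Fin 2) ℂ),
    (∀ i, (u i).support.card ≤ 2) → (∀ i, (v i).support.card ≤ 2) →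
    (∀ i, MvPolynomial.coeff 0 (u i) = 1) → (∀ i, MvPolynomial.coeff 0 (v i) = 1) →
    {e : Fin 2 →₀ ℕ | ∃ w : Fin 2 → ℤ, 0 < w 0 ∧ 0 < w 1 ∧ ∀ R : ℕ, w 0 * (e 0 : ℤ) + w 1 * (e 1 : ℤ) < (R : ℤ) →
      (e ∈ (∑ r ∈ Finset.Icc 1 R, ((-1 : ℂ) ^ (r + 1) / (r : ℂ)) •
            (∑ i, (u i - 1) ^ r - ∑ i, (v i - 1) ^ r)).support ∧
        ∀ e' ∈ (∑ r ∈ Finset.Icc 1 R, ((-1 : ℂ) ^ (r + 1) / (r : ℂ)) •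
            (∑ i, (u i - 1) ^ r - ∑ i, (v i - 1) ^ r)).support, e' ≠ e →
          w 0 * (e 0 : ℤ) + w 1 * (e 1 : ℤ) < w 0 * (e' 0 : ℤ) + w 1 * (e' 1 : ℤ))}.ncard ≤ 2 * n := by
  sorry

/-- STUB 7 — LOG-SUM NEWTON BOUND (OPEN — the engine, held by the lead; the card's Transfer `C⁺ = LogSumNewton`).  For
`t ≥ 3` and `t`-sparse factors with constant term `1`, the stable south-west vertices of `Λ = Σ log u_i − Σ log v_i`
number at most `2^(a n)·(t+2)^b`.  Equivalent to the crux up to the factor of stubs 2–4; known: `t = 2` (stub 6), common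
tail cone (`Theorems/TwoProducts/Negative/RankObstruction.lean`: `≤ 2n`), generic exponents (`O(n)`); Disproof F9's
first-order count `≤ 2n(t−1)` is a stronger open form. -/
theorem stub_logSumNewton : ∃ a b : ℕ, ∀ (n t : ℕ) (u v : Fin n → MvPolynomial (Fin 2) ℂ), 3 ≤ t →
    (∀ i, (u i).support.card ≤ t) → (∀ i, (v i).support.card ≤ t) →
    (∀ i, MvPolynomial.coeff 0 (u i) = 1) → (∀ i, MvPolynomial.coeff 0 (v i) = 1) →
    {e : Fin 2 →₀ ℕ | ∃ w : Fin 2 → ℤ, 0 < w 0 ∧ 0 < w 1 ∧ ∀ R : ℕ, w 0 * (e 0 : ℤ) + w 1 * (e 1 : ℤ) < (R : ℤ) →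
      (e ∈ (∑ r ∈ Finset.Icc 1 R, ((-1 : ℂ) ^ (r + 1) / (r : ℂ)) •
            (∑ i, (u i - 1) ^ r - ∑ i, (v i - 1) ^ r)).support ∧
        ∀ e' ∈ (∑ r ∈ Finset.Icc 1 R, ((-1 : ℂ) ^ (r + 1) / (r : ℂ)) •
            (∑ i, (u i - 1) ^ r - ∑ i, (v i - 1) ^ r)).support, e' ≠ e →
          w 0 * (e 0 : ℤ) + w 1 * (e 1 : ℤ) < w 0 * (e' 0 : ℤ) + w 1 * (e' 1 : ℤ))}.ncard
      ≤ 2 ^ (a * n) * (t + 2) ^ b := by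
  sorry

/-! ## The stub statements as named `Prop`s (definitionally the registered statements, in the line's vocabulary) -/

namespace Stmt

/-- Statement of stub 1. -/
def stub_exposure : Prop := ∀ (S : Finset Expo) (p : Fin 2 → ℝ),
    p ∈ Set.extremePoints ℝ (convexHull ℝ (emb '' (S : Set Expo))) →
    ∃ e : Expo, emb e = p ∧ ∃ w : Fin 2 → ℤ, IsStrictMin w S e

/-- Statement of stub 2. -/
def stub_sweep : Prop := ∀ (D : Finset (Fin 2 → ℤ)),
    ∃ Sec : Finset ((Fin 2 → ℤ) × (Fin 2 → ℤ)), Sec.card ≤ 4 * D.card + 4 ∧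
      ∀ w : Fin 2 → ℤ, w 0 ≠ 0 → w 1 ≠ 0 → (∀ d ∈ D, w 0 * d 0 + w 1 * d 1 ≠ 0) →
        ∃ rr ∈ Sec, rr.1 0 * rr.2 1 ≠ rr.1 1 * rr.2 0 ∧
          ∃ a b K : ℤ, 0 < a ∧ 0 < b ∧ 0 < K ∧ K • w = a • rr.1 + b • rr.2 ∧
            ∀ d ∈ D, 0 < w 0 * d 0 + w 1 * d 1 →
              0 ≤ rr.1 0 * d 0 + rr.1 1 * d 1 ∧ 0 ≤ rr.2 0 * d 0 + rr.2 1 * d 1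

/-- The sweep property of a sector family relative to the factors `(f, g)` (hypothesis of stub 3). -/
def SweepFor (f g : Fin m → MvPolynomial (Fin 2) ℂ) (Sec : Finset ((Fin 2 → ℤ) × (Fin 2 → ℤ))) : Prop :=
  ∀ w : Fin 2 → ℤ, w 0 ≠ 0 → w 1 ≠ 0 →
    (∀ j, ∀ p ∈ (f j).support, ∀ q ∈ (f j).support, p ≠ q → wt w p ≠ wt w q) →
    (∀ j, ∀ p ∈ (g j).support, ∀ q ∈ (g j).support, p ≠ q → wt w p ≠ wt w q) →
    ∃ rr ∈ Sec, rr.1 0 * rr.2 1 ≠ rr.1 1 * rr.2 0 ∧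
      ∃ a b K : ℤ, 0 < a ∧ 0 < b ∧ 0 < K ∧ K • w = a • rr.1 + b • rr.2 ∧
        (∀ j, ∀ p ∈ (f j).support, ∀ q ∈ (f j).support, wt w p < wt w q →
          wt rr.1 p ≤ wt rr.1 q ∧ wt rr.2 p ≤ wt rr.2 q) ∧
        (∀ j, ∀ p ∈ (g j).support, ∀ q ∈ (g j).support, wt w p < wt w q →
          wt rr.1 p ≤ wt rr.1 q ∧ wt rr.2 p ≤ wt rr.2 q)

/-- Statement of stub 3. -/
def stub_sectorCover : Prop := ∀ (m t : ℕ) (f g : Fin m → MvPolynomial (Fin 2) ℂ),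
    (∀ j, (f j).support.card ≤ t) → (∀ j, (g j).support.card ≤ t) → (∀ j, f j ≠ 0) → (∀ j, g j ≠ 0) →
    ∀ (Sec : Finset ((Fin 2 → ℤ) × (Fin 2 → ℤ))), SweepFor f g Sec →
    ∀ B : ℕ, (∀ (μ ν : Fin m → Expo) (r₁ r₂ : Fin 2 → ℤ), Adapted f g μ ν r₁ r₂ →
      (sectSet f g μ ν r₁ r₂).ncard ≤ B) →
    (vertSet (∏ j, f j - ∏ j, g j)).ncard ≤ Sec.card * B

/-- Statement of stub 4. -/
def stub_coneChart : Prop := ∀ (m t : ℕ) (f g : Fin m → MvPolynomial (Fin 2) ℂ),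
    (∀ j, (f j).support.card ≤ t) → (∀ j, (g j).support.card ≤ t) →
    ∀ (μ ν : Fin m → Expo) (r₁ r₂ : Fin 2 → ℤ), Adapted f g μ ν r₁ r₂ → (sectSet f g μ ν r₁ r₂).Nonempty →
    ∃ u v : Fin m → MvPolynomial (Fin 2) ℂ,
      (∀ i, (u i).support.card ≤ t) ∧ (∀ i, (v i).support.card ≤ t) ∧
      (∀ i, MvPolynomial.coeff 0 (u i) = 1) ∧ (∀ i, MvPolynomial.coeff 0 (v i) = 1) ∧
      (sectSet f g μ ν r₁ r₂).ncard ≤ (swVertSet (∏ i, u i - ∏ i, v i)).ncard + 2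

/-- Statement of stub 5. -/
def stub_powerSumCriterion : Prop := ∀ (n : ℕ) (u v : Fin n → MvPolynomial (Fin 2) ℂ),
    (∀ i, MvPolynomial.coeff 0 (u i) = 1) → (∀ i, MvPolynomial.coeff 0 (v i) = 1) →
    ∀ (w : Fin 2 → ℤ), 0 < w 0 → 0 < w 1 →
    ∀ (e : Expo) (R : ℕ), wt w e < (R : ℤ) →
      (IsStrictMin w (∏ i, u i - ∏ i, v i).support e ↔ IsStrictMin w (logPowerSum R u v).support e)

/-- Statement of stub 6. -/
def stub_raySeries : Prop := ∀ (n : ℕ) (u v : Fin n → MvPolynomial (Fin 2) ℂ),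
    (∀ i, (u i).support.card ≤ 2) → (∀ i, (v i).support.card ≤ 2) →
    (∀ i, MvPolynomial.coeff 0 (u i) = 1) → (∀ i, MvPolynomial.coeff 0 (v i) = 1) →
    (logVertSet u v).ncard ≤ 2 * n

/-- Statement of stub 7 (the engine). -/
def stub_logSumNewton : Prop := ∃ a b : ℕ, ∀ (n t : ℕ) (u v : Fin n → MvPolynomial (Fin 2) ℂ), 3 ≤ t →
    (∀ i, (u i).support.card ≤ t) → (∀ i, (v i).support.card ≤ t) →
    (∀ i, MvPolynomial.coeff 0 (u i) = 1) → (∀ i, MvPolynomial.coeff 0 (v i) = 1) →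
    (logVertSet u v).ncard ≤ 2 ^ (a * n) * (t + 2) ^ b

end Stmt

/-! ### The registered stubs prove the named statements (definitional unfolding only) -/

theorem holds_stub_exposure : Stmt.stub_exposure := stub_exposure
theorem holds_stub_sweep : Stmt.stub_sweep := stub_sweep
theorem holds_stub_sectorCover : Stmt.stub_sectorCover := stub_sectorCover
theorem holds_stub_coneChart : Stmt.stub_coneChart := stub_coneChart
theorem holds_stub_powerSumCriterion : Stmt.stub_powerSumCriterion := stub_powerSumCriterion
theorem holds_stub_raySeries : Stmt.stub_raySeries := stub_raySeries
theorem holds_stub_logSumNewton : Stmt.stub_logSumNewton := stub_logSumNewton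

/-! ## Proved glue -/

/-- `2 n ≤ 2^n`. -/
theorem two_mul_le_two_pow (n : ℕ) : 2 * n ≤ 2 ^ n := by
  induction n with
  | zero => simp
  | succ k ih =>
    rcases Nat.eq_zero_or_pos k with hk | hk
    · subst hk; simp
    · have h1 : 2 ≤ 2 ^ k := by
        calc 2 = 2 * 1 := by ring
          _ ≤ 2 * k := Nat.mul_le_mul_left 2 hk
          _ ≤ 2 ^ k := ih
      calc 2 * (k + 1) = 2 * k + 2 := by ring
        _ ≤ 2 ^ k + 2 ^ k := Nat.add_le_add ih h1
        _ = 2 ^ (k + 1) := by ring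

/-- Monotonicity of the bound shape in the constant `a`. -/
theorem shape_mono (a a' b n t : ℕ) (h : a ≤ a') :
    2 ^ (a * n) * (t + 2) ^ b ≤ 2 ^ (a' * n) * (t + 2) ^ b :=
  Nat.mul_le_mul_right _ (Nat.pow_le_pow_right (by norm_num) (Nat.mul_le_mul_right n h))

/-- From the power-sum criterion: the south-west vertices of a local instance ARE the stable log vertices. -/
theorem swVertSet_eq_logVertSet (hPS : Stmt.stub_powerSumCriterion) {n : ℕ}
    (u v : Fin n → MvPolynomial (Fin 2) ℂ)
    (hu : ∀ i, MvPolynomial.coeff 0 (u i) = 1) (hv : ∀ i, MvPolynomial.coeff 0 (v i) = 1) :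
    swVertSet (∏ i, u i - ∏ i, v i) = logVertSet u v := by
  ext e
  constructor
  · rintro ⟨w, hw0, hw1, h⟩
    exact ⟨w, hw0, hw1, fun R hR => (hPS n u v hu hv w hw0 hw1 e R hR).1 h⟩
  · rintro ⟨w, hw0, hw1, h⟩
    refine ⟨w, hw0, hw1, ?_⟩
    have hR : wt w e < ((wt w e).toNat + 1 : ℕ) := by
      have := Int.self_le_toNat (wt w e)
      push_cast
      omega
    exact (hPS n u v hu hv w hw0 hw1 e _ hR).2 (h _ hR)

/-- LOCAL BOUND from stubs 5–7: every local instance satisfies the south-west bound with constants `(a+1, b)`. -/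
theorem local_bound (hPS : Stmt.stub_powerSumCriterion) (hRay : Stmt.stub_raySeries) {a b : ℕ}
    (hLog : ∀ (n t : ℕ) (u v : Fin n → MvPolynomial (Fin 2) ℂ), 3 ≤ t →
      (∀ i, (u i).support.card ≤ t) → (∀ i, (v i).support.card ≤ t) →
      (∀ i, MvPolynomial.coeff 0 (u i) = 1) → (∀ i, MvPolynomial.coeff 0 (v i) = 1) →
      (logVertSet u v).ncard ≤ 2 ^ (a * n) * (t + 2) ^ b) :
    ∀ (n t : ℕ) (u v : Fin n → MvPolynomial (Fin 2) ℂ),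
      (∀ i, (u i).support.card ≤ t) → (∀ i, (v i).support.card ≤ t) →
      (∀ i, MvPolynomial.coeff 0 (u i) = 1) → (∀ i, MvPolynomial.coeff 0 (v i) = 1) →
      (swVertSet (∏ i, u i - ∏ i, v i)).ncard ≤ 2 ^ ((a + 1) * n) * (t + 2) ^ b := by
  intro n t u v hut hvt hu hv
  rw [swVertSet_eq_logVertSet hPS u v hu hv]
  by_cases ht : t ≤ 2
  · have h := hRay n u v (fun i => (hut i).trans ht) (fun i => (hvt i).trans ht) hu hv
    calc (logVertSet u v).ncard ≤ 2 * n := h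
      _ ≤ 2 ^ n := two_mul_le_two_pow n
      _ = 2 ^ (1 * n) * (t + 2) ^ 0 := by ring
      _ ≤ 2 ^ ((a + 1) * n) * (t + 2) ^ 0 := shape_mono 1 (a + 1) 0 n t (by omega)
      _ ≤ 2 ^ ((a + 1) * n) * (t + 2) ^ b :=
          Nat.mul_le_mul_left _ (Nat.pow_le_pow_right (by omega) (Nat.zero_le b))
  · have h := hLog n t u v (by omega) hut hvt hu hv
    exact h.trans (shape_mono a (a + 1) b n t (by omega))

/-- PER-SECTOR BOUND from stub 4 and a local bound `N`: every adapted sector datum has `≤ N + 2` sector vertices. -/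
theorem sect_bound (hChart : Stmt.stub_coneChart) {N m t : ℕ} (f g : Fin m → MvPolynomial (Fin 2) ℂ)
    (hf : ∀ j, (f j).support.card ≤ t) (hg : ∀ j, (g j).support.card ≤ t)
    (hloc : ∀ (u v : Fin m → MvPolynomial (Fin 2) ℂ),
      (∀ i, (u i).support.card ≤ t) → (∀ i, (v i).support.card ≤ t) →
      (∀ i, MvPolynomial.coeff 0 (u i) = 1) → (∀ i, MvPolynomial.coeff 0 (v i) = 1) →
      (swVertSet (∏ i, u i - ∏ i, v i)).ncard ≤ N)
    (μ ν : Fin m → Expo) (r₁ r₂ : Fin 2 → ℤ) (hA : Adapted f g μ ν r₁ r₂) :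
    (sectSet f g μ ν r₁ r₂).ncard ≤ N + 2 := by
  rcases (sectSet f g μ ν r₁ r₂).eq_empty_or_nonempty with h0 | hne
  · rw [h0, Set.ncard_empty]; exact Nat.zero_le _
  · obtain ⟨u, v, hu, hv, hu1, hv1, hle⟩ := hChart m t f g hf hg μ ν r₁ r₂ hA hne
    exact hle.trans (Nat.add_le_add_right (hloc u v hu hv hu1 hv1) 2)

/-! ### The within-factor difference vectors and the sweep hypothesis of stub 3 -/

/-- The integer difference vector `p − q` of two exponents. -/
def dvec (p q : Expo) : Fin 2 → ℤ := fun i => (p i : ℤ) - (q i : ℤ)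

/-- All within-factor difference vectors `p − q`, `p ≠ q` in the support of one factor (both families, both signs). -/
def diffs (f g : Fin m → MvPolynomial (Fin 2) ℂ) : Finset (Fin 2 → ℤ) :=
  (Finset.univ.biUnion fun j => (f j).support.offDiag.image fun pq => dvec pq.1 pq.2) ∪
  (Finset.univ.biUnion fun j => (g j).support.offDiag.image fun pq => dvec pq.1 pq.2)

theorem wt_sub (w : Fin 2 → ℤ) (p q : Expo) :
    wt w p - wt w q = w 0 * dvec p q 0 + w 1 * dvec p q 1 := by
  simp only [wt, dvec]; ring

theorem card_diffs_le (t : ℕ) (f g : Fin m → MvPolynomial (Fin 2) ℂ)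
    (hf : ∀ j, (f j).support.card ≤ t) (hg : ∀ j, (g j).support.card ≤ t) :
    (diffs f g).card ≤ 2 * m * t ^ 2 := by
  have h1 : ∀ (h : Fin m → MvPolynomial (Fin 2) ℂ), (∀ j, (h j).support.card ≤ t) →
      (Finset.univ.biUnion fun j => (h j).support.offDiag.image fun pq => dvec pq.1 pq.2).card ≤ m * t ^ 2 := by
    intro h hh
    calc _ ≤ ∑ j : Fin m, ((h j).support.offDiag.image fun pq => dvec pq.1 pq.2).card :=
          Finset.card_biUnion_le
      _ ≤ ∑ _j : Fin m, t ^ 2 := Finset.sum_le_sum fun j _ => by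
          calc _ ≤ (h j).support.offDiag.card := Finset.card_image_le
            _ = (h j).support.card * (h j).support.card - (h j).support.card := Finset.offDiag_card _
            _ ≤ (h j).support.card * (h j).support.card := Nat.sub_le _ _
            _ ≤ t * t := Nat.mul_le_mul (hh j) (hh j)
            _ = t ^ 2 := (sq t).symm
      _ = m * t ^ 2 := by simp
  calc (diffs f g).card ≤ _ + _ := Finset.card_union_le _ _
    _ ≤ m * t ^ 2 + m * t ^ 2 := Nat.add_le_add (h1 f hf) (h1 g hg)
    _ = 2 * m * t ^ 2 := by ring

theorem mem_diffs_f (f g : Fin m → MvPolynomial (Fin 2) ℂ) (j : Fin m) {p q : Expo}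
    (hp : p ∈ (f j).support) (hq : q ∈ (f j).support) (hpq : p ≠ q) : dvec p q ∈ diffs f g :=
  Finset.mem_union_left _ (Finset.mem_biUnion.2 ⟨j, Finset.mem_univ _,
    Finset.mem_image.2 ⟨(p, q), Finset.mem_offDiag.2 ⟨hp, hq, hpq⟩, rfl⟩⟩)

theorem mem_diffs_g (f g : Fin m → MvPolynomial (Fin 2) ℂ) (j : Fin m) {p q : Expo}
    (hp : p ∈ (g j).support) (hq : q ∈ (g j).support) (hpq : p ≠ q) : dvec p q ∈ diffs f g :=
  Finset.mem_union_right _ (Finset.mem_biUnion.2 ⟨j, Finset.mem_univ _,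
    Finset.mem_image.2 ⟨(p, q), Finset.mem_offDiag.2 ⟨hp, hq, hpq⟩, rfl⟩⟩)

/-- The sweep (stub 2) applied to the within-factor differences yields the sweep hypothesis of stub 3. -/
theorem sweepFor_of_sweep (hSweep : Stmt.stub_sweep) (f g : Fin m → MvPolynomial (Fin 2) ℂ) :
    ∃ Sec : Finset ((Fin 2 → ℤ) × (Fin 2 → ℤ)), Sec.card ≤ 4 * (diffs f g).card + 4 ∧ Stmt.SweepFor f g Sec := by
  obtain ⟨Sec, hcard, hsw⟩ := hSweep (diffs f g)
  refine ⟨Sec, hcard, ?_⟩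
  intro w hw0 hw1 hgenf hgeng
  have hD : ∀ d ∈ diffs f g, w 0 * d 0 + w 1 * d 1 ≠ 0 := by
    intro d hd
    simp only [diffs, Finset.mem_union, Finset.mem_biUnion, Finset.mem_univ, true_and,
      Finset.mem_image, Finset.mem_offDiag, Prod.exists] at hd
    rcases hd with ⟨j, p, q, ⟨hp, hq, hpq⟩, rfl⟩ | ⟨j, p, q, ⟨hp, hq, hpq⟩, rfl⟩
    · have := hgenf j p hp q hq hpq
      rwa [Ne, ← sub_eq_zero, wt_sub] at this
    · have := hgeng j p hp q hq hpq
      rwa [Ne, ← sub_eq_zero, wt_sub] at this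
  obtain ⟨rr, hrr, hdet, a, b, K, ha, hb, hK, hKw, hsign⟩ := hsw w hw0 hw1 hD
  refine ⟨rr, hrr, hdet, a, b, K, ha, hb, hK, hKw, ?_, ?_⟩
  · intro j p hp q hq hlt
    have hpq : q ≠ p := fun h => by subst h; exact lt_irrefl _ hlt
    have hpos : 0 < w 0 * dvec q p 0 + w 1 * dvec q p 1 := by rw [← wt_sub]; omega
    have h := hsign _ (mem_diffs_f f g j hq hp hpq) hpos
    have e1 := wt_sub rr.1 q p
    have e2 := wt_sub rr.2 q p
    constructor <;> omega
  · intro j p hp q hq hlt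
    have hpq : q ≠ p := fun h => by subst h; exact lt_irrefl _ hlt
    have hpos : 0 < w 0 * dvec q p 0 + w 1 * dvec q p 1 := by rw [← wt_sub]; omega
    have h := hsign _ (mem_diffs_g f g j hq hp hpq) hpos
    have e1 := wt_sub rr.1 q p
    have e2 := wt_sub rr.2 q p
    constructor <;> omega

/-! ### The vertex bound for nonzero factors, and the reduction of zero factors (doubling trick) -/

/-- NONZERO FACTORS: `#vertSet(∏f − ∏g) ≤ (8mt² + 4)·(N + 2)` from stubs 2–4 and a local bound `N`. -/
theorem vert_bound_nonzero (h2 : Stmt.stub_sweep) (h3 : Stmt.stub_sectorCover) (h4 : Stmt.stub_coneChart)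
    {N m t : ℕ} (f g : Fin m → MvPolynomial (Fin 2) ℂ)
    (hf : ∀ j, (f j).support.card ≤ t) (hg : ∀ j, (g j).support.card ≤ t)
    (hf0 : ∀ j, f j ≠ 0) (hg0 : ∀ j, g j ≠ 0)
    (hloc : ∀ (u v : Fin m → MvPolynomial (Fin 2) ℂ),
      (∀ i, (u i).support.card ≤ t) → (∀ i, (v i).support.card ≤ t) →
      (∀ i, MvPolynomial.coeff 0 (u i) = 1) → (∀ i, MvPolynomial.coeff 0 (v i) = 1) →
      (swVertSet (∏ i, u i - ∏ i, v i)).ncard ≤ N) :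
    (vertSet (∏ j, f j - ∏ j, g j)).ncard ≤ (8 * m * t ^ 2 + 4) * (N + 2) := by
  obtain ⟨Sec, hcard, hSF⟩ := sweepFor_of_sweep h2 f g
  have h := h3 m t f g hf hg hf0 hg0 Sec hSF (N + 2)
    (fun μ ν r₁ r₂ hA => sect_bound h4 f g hf hg hloc μ ν r₁ r₂ hA)
  have hD := card_diffs_le t f g hf hg
  calc (vertSet (∏ j, f j - ∏ j, g j)).ncard ≤ Sec.card * (N + 2) := h
    _ ≤ (4 * (diffs f g).card + 4) * (N + 2) := Nat.mul_le_mul_right _ hcard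
    _ ≤ (8 * m * t ^ 2 + 4) * (N + 2) := Nat.mul_le_mul_right _ (by
        calc 4 * (diffs f g).card + 4 ≤ 4 * (2 * m * t ^ 2) + 4 := by omega
          _ = 8 * m * t ^ 2 + 4 := by ring)

/-- The combinatorial vertex set depends only on the support. -/
theorem vertSet_congr {F G : MvPolynomial (Fin 2) ℂ} (h : F.support = G.support) : vertSet F = vertSet G := by
  simp only [vertSet, h]

/-- Doubling one factor: `∏_j (if j = j₀ then 2 else 1)·h_j = 2·∏_j h_j`. -/
theorem prod_double (h : Fin m → MvPolynomial (Fin 2) ℂ) (j₀ : Fin m) :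
    (∏ j, (if j = j₀ then (MvPolynomial.C 2 : MvPolynomial (Fin 2) ℂ) else 1) * h j) =
      MvPolynomial.C 2 * ∏ j, h j := by
  rw [Finset.prod_mul_distrib, Finset.prod_ite_eq']
  simp

theorem support_double (p : MvPolynomial (Fin 2) ℂ) :
    (MvPolynomial.C (2 : ℂ) * p).support = p.support := by
  rw [MvPolynomial.C_mul', MvPolynomial.support_smul_eq (two_ne_zero)]

/-- GENERAL FACTORS: the same bound, the zero-factor cases being reduced to nonzero families. -/
theorem vert_bound (h2 : Stmt.stub_sweep) (h3 : Stmt.stub_sectorCover) (h4 : Stmt.stub_coneChart)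
    {N m t : ℕ} (f g : Fin m → MvPolynomial (Fin 2) ℂ)
    (hf : ∀ j, (f j).support.card ≤ t) (hg : ∀ j, (g j).support.card ≤ t)
    (hloc : ∀ (u v : Fin m → MvPolynomial (Fin 2) ℂ),
      (∀ i, (u i).support.card ≤ t) → (∀ i, (v i).support.card ≤ t) →
      (∀ i, MvPolynomial.coeff 0 (u i) = 1) → (∀ i, MvPolynomial.coeff 0 (v i) = 1) →
      (swVertSet (∏ i, u i - ∏ i, v i)).ncard ≤ N) :
    (vertSet (∏ j, f j - ∏ j, g j)).ncard ≤ (8 * m * t ^ 2 + 4) * (N + 2) := by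
  by_cases hf0 : ∀ j, f j ≠ 0
  · by_cases hg0 : ∀ j, g j ≠ 0
    · exact vert_bound_nonzero h2 h3 h4 f g hf hg hf0 hg0 hloc
    · -- some `g j₀ = 0`: `∏f − ∏g = ∏f = ∏f' − ∏f` with `f'` = `f` doubled at `j₀`
      push Not at hg0
      obtain ⟨j₀, hj₀⟩ := hg0
      have hpg : (∏ j, g j) = 0 := Finset.prod_eq_zero (Finset.mem_univ j₀) hj₀
      set f' : Fin m → MvPolynomial (Fin 2) ℂ :=
        fun j => (if j = j₀ then (MvPolynomial.C 2 : MvPolynomial (Fin 2) ℂ) else 1) * f j with hf'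
      have hprod : (∏ j, f' j) - ∏ j, f j = (∏ j, f j) - ∏ j, g j := by
        rw [hpg, sub_zero, hf', prod_double, MvPolynomial.C_mul', two_smul, add_sub_cancel_right]
      have hsupp' : ∀ j, (f' j).support = (f j).support := by
        intro j; simp only [hf']
        split_ifs
        · exact support_double _
        · rw [one_mul]
      have hf'0 : ∀ j, f' j ≠ 0 := by
        intro j h0
        have := hsupp' j
        rw [h0, MvPolynomial.support_zero] at this
        exact hf0 j (MvPolynomial.support_eq_empty.1 this.symm)
      have key := vert_bound_nonzero h2 h3 h4 f' f (fun j => by rw [hsupp' j]; exact hf j) hf hf'0 hf0 hloc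
      rwa [hprod] at key
  · push Not at hf0
    obtain ⟨j₀, hj₀⟩ := hf0
    have hpf : (∏ j, f j) = 0 := Finset.prod_eq_zero (Finset.mem_univ j₀) hj₀
    by_cases hg0 : ∀ j, g j ≠ 0
    · -- `∏f − ∏g = −∏g`, same support as `∏g = ∏g' − ∏g`
      set g' : Fin m → MvPolynomial (Fin 2) ℂ :=
        fun j => (if j = j₀ then (MvPolynomial.C 2 : MvPolynomial (Fin 2) ℂ) else 1) * g j with hg'
      have hprod : (∏ j, g' j) - ∏ j, g j = ∏ j, g j := by
        rw [hg', prod_double, MvPolynomial.C_mul', two_smul, add_sub_cancel_right]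
      have hsupp : ((∏ j, f j) - ∏ j, g j).support = ((∏ j, g' j) - ∏ j, g j).support := by
        rw [hprod, hpf, zero_sub, MvPolynomial.support_neg]
      have hsupp' : ∀ j, (g' j).support = (g j).support := by
        intro j; simp only [hg']
        split_ifs
        · exact support_double _
        · rw [one_mul]
      have hg'0 : ∀ j, g' j ≠ 0 := by
        intro j h0
        have := hsupp' j
        rw [h0, MvPolynomial.support_zero] at this
        exact hg0 j (MvPolynomial.support_eq_empty.1 this.symm)
      have key := vert_bound_nonzero h2 h3 h4 g' g (fun j => by rw [hsupp' j]; exact hg j) hg hg'0 hg0 hloc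
      rwa [vertSet_congr hsupp]
    · push Not at hg0
      obtain ⟨j₁, hj₁⟩ := hg0
      have hpg : (∏ j, g j) = 0 := Finset.prod_eq_zero (Finset.mem_univ j₁) hj₁
      have h0 : vertSet ((∏ j, f j) - ∏ j, g j) = ∅ := by
        rw [hpf, hpg, sub_zero]
        ext e
        simp [vertSet, IsStrictMin]
      rw [h0, Set.ncard_empty]
      exact Nat.zero_le _

/-! ### Arithmetic -/

/-- The final arithmetic: `(8mt² + 4)·(2^((a+1)m)(t+2)^b + 2) ≤ 2^((a+2)m)·(t+2)^(b+8)`. -/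
theorem bound_arith (a b m t : ℕ) :
    (8 * m * t ^ 2 + 4) * (2 ^ ((a + 1) * m) * (t + 2) ^ b + 2) ≤ 2 ^ ((a + 2) * m) * (t + 2) ^ (b + 8) := by
  set X : ℕ := 2 ^ ((a + 1) * m) * (t + 2) ^ b with hX
  have hX1 : 1 ≤ X := Nat.one_le_iff_ne_zero.2 (by positivity)
  have hm : m ≤ 2 ^ m := Nat.lt_two_pow_self.le
  have h12 : 1 ≤ 2 ^ m := Nat.one_le_two_pow
  have ht : t ^ 2 ≤ (t + 2) ^ 2 := Nat.pow_le_pow_left (by omega) 2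
  have h4 : 4 ≤ (t + 2) ^ 2 := by
    calc 4 = 2 ^ 2 := by norm_num
      _ ≤ (t + 2) ^ 2 := Nat.pow_le_pow_left (by omega) 2
  -- first factor
  have hA : 8 * m * t ^ 2 + 4 ≤ 16 * (2 ^ m * (t + 2) ^ 2) := by
    have e1 : 8 * m * t ^ 2 ≤ 8 * (2 ^ m * (t + 2) ^ 2) := by
      calc 8 * m * t ^ 2 = 8 * (m * t ^ 2) := by ring
        _ ≤ 8 * (2 ^ m * (t + 2) ^ 2) := by gcongr
    have e2 : 4 ≤ 8 * (2 ^ m * (t + 2) ^ 2) := by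
      calc 4 ≤ 1 * 4 := by norm_num
        _ ≤ 2 ^ m * (t + 2) ^ 2 := Nat.mul_le_mul h12 h4
        _ ≤ 8 * (2 ^ m * (t + 2) ^ 2) := by omega
    omega
  -- second factor
  have hB : X + 2 ≤ 4 * X := by omega
  have h64 : 64 ≤ (t + 2) ^ 6 := by
    calc 64 = 2 ^ 6 := by norm_num
      _ ≤ (t + 2) ^ 6 := Nat.pow_le_pow_left (by omega) 6
  calc (8 * m * t ^ 2 + 4) * (X + 2) ≤ (16 * (2 ^ m * (t + 2) ^ 2)) * (4 * X) := Nat.mul_le_mul hA hB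
    _ = 64 * (2 ^ m * X) * (t + 2) ^ 2 := by ring
    _ ≤ (t + 2) ^ 6 * (2 ^ m * X) * (t + 2) ^ 2 := by gcongr
    _ = 2 ^ ((a + 2) * m) * (t + 2) ^ (b + 8) := by rw [hX]; ring

/-! ## The composition -/

/-- COMPOSITION.  The seven stubs imply the crux BY NAME, with `(A, B) = (a + 2, b + 8)` from the engine's `(a, b)`. -/
theorem TwoProducts_of :
    Stmt.stub_exposure → Stmt.stub_sweep → Stmt.stub_sectorCover → Stmt.stub_coneChart →
      Stmt.stub_powerSumCriterion → Stmt.stub_raySeries → Stmt.stub_logSumNewton →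
      Summit.ValiantsHypothesis.ValiantsHypothesis.Theses.NewtonUnitEquations.TwoProducts := by
  intro h1 h2 h3 h4 h5 h6 h7
  obtain ⟨a, b, hLog⟩ := h7
  refine ⟨a + 2, b + 8, ?_⟩
  intro m t f g hf hg
  -- local bound with constants (a+1, b) at n = m, then the global combinatorial vertex bound
  have hlocal := local_bound h5 h6 hLog
  have hvert := vert_bound h2 h3 h4 (N := 2 ^ ((a + 1) * m) * (t + 2) ^ b) f g hf hg
    (fun u v hu hv hu1 hv1 => hlocal m t u v hu hv hu1 hv1)
  set F : MvPolynomial (Fin 2) ℂ := ∏ j, f j - ∏ j, g j with hF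
  -- extreme points inject into `emb '' vertSet F`
  have hfin : (vertSet F).Finite := by
    refine Set.Finite.subset (Finset.finite_toSet F.support) ?_
    rintro e ⟨w, he, -⟩
    exact Finset.mem_coe.2 he
  have hcover : Set.extremePoints ℝ (convexHull ℝ ((fun e : Fin 2 →₀ ℕ => fun i : Fin 2 =>
      ((e i : ℕ) : ℝ)) '' (F.support : Set (Fin 2 →₀ ℕ)))) ⊆ emb '' vertSet F := by
    intro p hp
    obtain ⟨e, hep, w, hw⟩ := h1 F.support p hp
    exact ⟨e, ⟨w, hw⟩, hep⟩
  calc (Set.extremePoints ℝ (convexHull ℝ ((fun e : Fin 2 →₀ ℕ => fun i : Fin 2 =>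
          ((e i : ℕ) : ℝ)) '' (F.support : Set (Fin 2 →₀ ℕ))))).ncard
        ≤ (emb '' vertSet F).ncard := Set.ncard_le_ncard hcover (hfin.image _)
    _ ≤ (vertSet F).ncard := Set.ncard_image_le hfin
    _ ≤ (8 * m * t ^ 2 + 4) * (2 ^ ((a + 1) * m) * (t + 2) ^ b + 2) := hvert
    _ ≤ 2 ^ ((a + 2) * m) * (t + 2) ^ (b + 8) := bound_arith a b m t

/-- THE SKELETON: the crux, modulo exactly the seven registered stubs. -/
theorem TwoProducts_proof :
    Summit.ValiantsHypothesis.ValiantsHypothesis.Theses.NewtonUnitEquations.TwoProducts :=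
  TwoProducts_of holds_stub_exposure holds_stub_sweep holds_stub_sectorCover holds_stub_coneChart
    holds_stub_powerSumCriterion holds_stub_raySeries holds_stub_logSumNewton

end

end Summit.ValiantsHypothesis.ValiantsHypothesis.Cruxes.TwoProducts.CornerLogLinearization
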